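import Literature.MathematicalPhysics.QuantumLattice.EuclideanAction
import Literature.MathematicalPhysics.QuantumLattice.LatticeScalarField
import Literature.Probability.LatticeModels.ThermodynamicLimit

/-!
# Stub `stub_lower` of line `dlr-collar-transfer` (crux `OSLegsFromFemtoAndGap`, stmt-QuantumFields-9367):
# auxiliary file 3 — bump test functions, lattice-point counting, scale selection

Elementary real-analysis helpers (Mathlib notions + the tree's `siteToE`, `box`, `thetaTest`):

* `exists_bump_schwartz`: a smooth bump `v ∈ 𝓢(ℝ⁴)` with `0 ≤ v ≤ 1`, `v = 1` on
  `closedBall c ρ`, `v = 0` off `ball c (2ρ)` (Mathlib `ContDiffBump` + `HasCompactSupport.toSchwartzMap`);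
* `pow_le_sum_box`: a function `g ≥ 0` equal to `1` on `closedBall p ρ` has lattice Riemann mass
  `Σ_{y ∈ box L} g(a y) ≥ (ρ/(2a))⁴` once `2a ≤ ρ` and the box covers the ball (count the lattice
  points of an inscribed cube) — the only "Riemann sum" input the lower bounds need;
* `exists_delta_of_tendsto_mul`, `exists_delta_of_tendsto_div_atTop`, `exists_of_tendsto_atTop_nhds_zero`:
  `ε/δ` forms of the growth clauses `s K(s) → 0`, `Γ(s)/sᵏ → ∞` at `0⁺` and of `a(β) → 0`;
* small Euclidean facts in `ℝ⁴` (`timeReflection` of `e₀`, coordinates vs norm, `siteToE` is additive).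
-/

set_option autoImplicit false

noncomputable section

open scoped SchwartzMap
open Filter Topology Metric
open Literature.MathematicalPhysics.QuantumLattice Literature.Probability.LatticeModels

namespace Summit.QuantumFields.YangMills.Theorems.OSLegsFromFemtoAndGap.StubLower

/-! ### Bump test functions -/

/-- A smooth bump in `𝓢(ℝ⁴, ℝ)`: values in `[0, 1]`, `= 1` on `closedBall c ρ`, vanishing off
`ball c (2ρ)`, `tsupport = closedBall c (2ρ)`. [folklore] -/
theorem exists_bump_schwartz (c : EuclideanSpace ℝ (Fin 4)) {ρ : ℝ} (hρ : 0 < ρ) :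
    ∃ v : 𝓢(EuclideanSpace ℝ (Fin 4), ℝ), (∀ z, 0 ≤ v z) ∧ (∀ z, v z ≤ 1) ∧
      (∀ z, dist z c ≤ ρ → v z = 1) ∧ (∀ z, v z ≠ 0 → dist z c < 2 * ρ) ∧
      tsupport v = closedBall c (2 * ρ) := by
  let f : ContDiffBump c := ⟨ρ, 2 * ρ, hρ, by linarith⟩
  refine ⟨f.hasCompactSupport.toSchwartzMap f.contDiff, fun z => f.nonneg, fun z => f.le_one,
    fun z hz => f.one_of_mem_closedBall (by simpa using hz), fun z hz => ?_, f.tsupport_eq⟩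
  have : z ∈ Function.support (f : EuclideanSpace ℝ (Fin 4) → ℝ) := hz
  rw [f.support_eq] at this
  simpa using this

/-! ### Small Euclidean facts in `ℝ⁴` -/

/-- Coordinates are bounded by the Euclidean norm. [folklore] -/
theorem abs_apply_le_norm (z : EuclideanSpace ℝ (Fin 4)) (j : Fin 4) : |z j| ≤ ‖z‖ := by
  simpa [Real.norm_eq_abs] using PiLp.norm_apply_le z j

/-- The Euclidean norm in `ℝ⁴` is at most twice the sup of the coordinates. [folklore] -/
theorem norm_le_two_mul_of_forall_abs_le (z : EuclideanSpace ℝ (Fin 4)) {t : ℝ} (ht : 0 ≤ t)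
    (h : ∀ j, |z j| ≤ t) : ‖z‖ ≤ 2 * t := by
  rw [EuclideanSpace.norm_eq, Real.sqrt_le_iff]
  refine ⟨by linarith, ?_⟩
  calc ∑ j, ‖z j‖ ^ 2 ≤ ∑ _j : Fin 4, t ^ 2 := Finset.sum_le_sum fun j _ => by
          rw [Real.norm_eq_abs]
          exact pow_le_pow_left₀ (abs_nonneg _) (h j) 2
    _ = (2 * t) ^ 2 := by simp; ring

/-- `siteToE` is additive: `siteToE (y - x) = siteToE y - siteToE x`. [folklore] -/
theorem siteToE_sub (x y : Site 4) : siteToE (y - x) = siteToE y - siteToE x := by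
  ext j; simp [siteToE_apply]

/-- Time reflection negates the time axis: `θ (t e₀) = -(t e₀)`. [folklore] -/
theorem timeReflection_single_zero (t : ℝ) :
    timeReflection 4 (EuclideanSpace.single 0 t) = -EuclideanSpace.single 0 t := by
  ext i
  rw [timeReflection_apply]
  by_cases hi : i = 0
  · subst hi; simp
  · simp [hi]

/-- `‖t e₀‖ = |t|`. [folklore] -/
theorem norm_single_zero (t : ℝ) :
    ‖(EuclideanSpace.single 0 t : EuclideanSpace ℝ (Fin 4))‖ = |t| := by
  simp

/-! ### Lattice-point counting: the Riemann mass of a plateau -/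

/-- Integers in `[l, u]` for `u - l ≥ 2`: at least `(u - l)/2` of them, as a real inequality on
`#Icc ⌈l⌉ ⌊u⌋ = (⌊u⌋ + 1 - ⌈l⌉).toNat`. [folklore] -/
theorem half_length_le_card_Icc {l u : ℝ} (h : 2 ≤ u - l) :
    (u - l) / 2 ≤ ((Finset.Icc ⌈l⌉ ⌊u⌋).card : ℝ) := by
  rw [Int.card_Icc]
  have h1 : (u - 1 : ℝ) < ⌊u⌋ := Int.sub_one_lt_floor u
  have h2 : (⌈l⌉ : ℝ) < l + 1 := Int.ceil_lt_add_one l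
  have h3 : ((⌊u⌋ + 1 - ⌈l⌉ : ℤ) : ℝ) ≤ (((⌊u⌋ + 1 - ⌈l⌉).toNat : ℕ) : ℝ) := by
    have := Int.self_le_toNat (⌊u⌋ + 1 - ⌈l⌉)
    exact_mod_cast this
  push_cast at h3
  linarith

/-- **Riemann mass of a plateau.** If `g ≥ 0` on `ℝ⁴` equals `1` on `closedBall p ρ`, `0 < a`,
`2a ≤ ρ`, and the box `[-L, L]⁴` covers the ball in lattice units (`|p j| + ρ ≤ a L`), then
`(ρ / (2a))⁴ ≤ Σ_{y ∈ box 4 L} g (a • y)`. [folklore] -/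
theorem pow_le_sum_box {g : EuclideanSpace ℝ (Fin 4) → ℝ} (hg0 : ∀ z, 0 ≤ g z)
    {p : EuclideanSpace ℝ (Fin 4)} {ρ a : ℝ} (ha : 0 < a) (hg1 : ∀ z, dist z p ≤ ρ → g z = 1)
    (hρa : 2 * a ≤ ρ) {L : ℕ} (hL : ∀ j, |p j| + ρ ≤ a * L) :
    (ρ / (2 * a)) ^ 4 ≤ ∑ y ∈ box 4 L, g (a • siteToE y) := by
  classical
  set S : Finset (Site 4) :=
    Fintype.piFinset fun j => Finset.Icc ⌈(p j - ρ / 2) / a⌉ ⌊(p j + ρ / 2) / a⌋ with hS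
  have hρ : 0 ≤ ρ := by linarith
  -- coordinates of points of `S` in physical units
  have hcoord : ∀ y ∈ S, ∀ j, |a * (y j : ℝ) - p j| ≤ ρ / 2 := by
    intro y hy j
    have hyj := Fintype.mem_piFinset.1 hy j
    rw [Finset.mem_Icc] at hyj
    have hl' : ((⌈(p j - ρ / 2) / a⌉ : ℤ) : ℝ) ≤ ((y j : ℤ) : ℝ) := by exact_mod_cast hyj.1
    have hu' : ((y j : ℤ) : ℝ) ≤ ((⌊(p j + ρ / 2) / a⌋ : ℤ) : ℝ) := by exact_mod_cast hyj.2
    have hl : (p j - ρ / 2) / a ≤ (y j : ℝ) := (Int.le_ceil _).trans hl'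
    have hu : (y j : ℝ) ≤ (p j + ρ / 2) / a := hu'.trans (Int.floor_le _)
    rw [div_le_iff₀ ha] at hl
    rw [le_div_iff₀ ha] at hu
    rw [abs_le]; constructor <;> linarith
  have hSbox : S ⊆ box 4 L := by
    intro y hy
    rw [mem_box]
    intro j
    have h1 := hcoord y hy j
    have h2 := hL j
    have h3 : |a * (y j : ℝ)| ≤ a * L := by
      have : a * (y j : ℝ) = (a * (y j : ℝ) - p j) + p j := by ring
      rw [this]
      exact (abs_add_le _ _).trans (by linarith)
    rw [abs_mul, abs_of_pos ha] at h3
    have h4 : |(y j : ℝ)| ≤ L := le_of_mul_le_mul_left h3 ha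
    rw [abs_le] at h4
    exact ⟨by exact_mod_cast h4.1, by exact_mod_cast h4.2⟩
  have hone : ∀ y ∈ S, g (a • siteToE y) = 1 := by
    intro y hy
    refine hg1 _ ?_
    rw [dist_eq_norm]
    have : ‖a • siteToE y - p‖ ≤ 2 * (ρ / 2) :=
      norm_le_two_mul_of_forall_abs_le _ (by linarith) fun j => by
        simpa [siteToE_apply] using hcoord y hy j
    linarith
  calc (ρ / (2 * a)) ^ 4 = ∏ _j : Fin 4, (ρ / a) / 2 := by
        rw [Finset.prod_const, Finset.card_univ, Fintype.card_fin]; ring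
    _ ≤ ∏ j : Fin 4, ((Finset.Icc ⌈(p j - ρ / 2) / a⌉ ⌊(p j + ρ / 2) / a⌋).card : ℝ) := by
        refine Finset.prod_le_prod (fun j _ => by positivity) fun j _ => ?_
        have h := half_length_le_card_Icc (l := (p j - ρ / 2) / a) (u := (p j + ρ / 2) / a) (by
          rw [← sub_div, le_div_iff₀ ha]; linarith)
        rwa [← sub_div, show p j + ρ / 2 - (p j - ρ / 2) = ρ by ring] at h
    _ = (S.card : ℝ) := by rw [hS, Fintype.card_piFinset]; push_cast; rfl
    _ = ∑ y ∈ S, g (a • siteToE y) := by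
        rw [Finset.card_eq_sum_ones, Nat.cast_sum]
        exact Finset.sum_congr rfl fun y hy => by rw [hone y hy]; simp
    _ ≤ ∑ y ∈ box 4 L, g (a • siteToE y) :=
        Finset.sum_le_sum_of_subset_of_nonneg hSbox fun y _ _ => hg0 _

/-! ### Scale selection from the growth clauses -/

/-- `ε/δ` form of `s K(s) → 0` at `0⁺`. [folklore] -/
theorem exists_delta_of_tendsto_mul {K : ℝ → ℝ}
    (hK : Tendsto (fun s : ℝ => s * K s) (nhdsWithin 0 (Set.Ioi 0)) (nhds 0)) {ε : ℝ} (hε : 0 < ε) :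
    ∃ δ : ℝ, 0 < δ ∧ ∀ t : ℝ, 0 < t → t < δ → t * K t < ε := by
  rw [Metric.tendsto_nhdsWithin_nhds] at hK
  obtain ⟨δ, hδ, h⟩ := hK ε hε
  refine ⟨δ, hδ, fun t ht htδ => ?_⟩
  have := h (show t ∈ Set.Ioi (0 : ℝ) from ht) (by simpa [abs_of_pos ht] using htδ)
  simp only [dist_zero_right, Real.norm_eq_abs] at this
  exact (le_abs_self _).trans_lt this

/-- `ε/δ` form of `Γ(s)/sᵏ → ∞` at `0⁺`. [folklore] -/
theorem exists_delta_of_tendsto_div_atTop {Γ : ℝ → ℝ} {k : ℕ}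
    (hΓ : Tendsto (fun s : ℝ => Γ s / s ^ k) (nhdsWithin 0 (Set.Ioi 0)) atTop) (M : ℝ) :
    ∃ δ : ℝ, 0 < δ ∧ ∀ t : ℝ, 0 < t → t < δ → M < Γ t / t ^ k := by
  have hev := hΓ.eventually (eventually_gt_atTop M)
  rw [eventually_nhdsWithin_iff, Metric.eventually_nhds_iff] at hev
  obtain ⟨δ, hδ, h⟩ := hev
  refine ⟨δ, hδ, fun t ht htδ => h (by simpa [abs_of_pos ht] using htδ) ht⟩

/-- `a(β) → 0`: eventually `a β < a₀`. [folklore] -/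
theorem exists_of_tendsto_atTop_nhds_zero {a : ℝ → ℝ} (ha : Tendsto a atTop (nhds 0)) {a₀ : ℝ}
    (ha₀ : 0 < a₀) : ∃ β₀ : ℝ, ∀ β, β₀ ≤ β → a β < a₀ := by
  obtain ⟨β₀, h⟩ := Metric.tendsto_atTop.1 ha a₀ ha₀
  exact ⟨β₀, fun β hβ => by
    have := h β hβ
    rw [Real.dist_0_eq_abs] at this
    exact (le_abs_self _).trans_lt this⟩

end Summit.QuantumFields.YangMills.Theorems.OSLegsFromFemtoAndGap.StubLower

end
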